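import Summits.Ventures.YMGap.Thresholds.OneLinkLawBiInvariance
import Summits.Ventures.YMGap.Thresholds.OneLinkLawConjugation
import Summits.Ventures.YMGap.Thresholds.OneLinkCoverReduction
import Summits.Ventures.YMGap.Thresholds.OneLinkPermutationSymmetry
import Mathlib.Analysis.SpecialFunctions.Trigonometric.Bounds
import HarnessLib

/-!
# The one-link certificate reduction: `OneLinkVarianceBound` / `OneLinkPoincareSUN` from point statements on representatives, up to symmetry, plus a cover

HONEST FRAMING.  Explicit strong-coupling bookkeeping for lattice `SU(N)` Yang–Mills (small `β`): the composition of three tree files into the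
exact LEAN-STATED SPEC that a numerical certificate for the one-link schemas discharges.  Certifies nothing; NOT weak coupling, NOT a continuum
statement, NOT a Yang–Mills mass-gap claim.  Cell `pub-ymgap` (venture `YMGap`), seat engine-2 (g13).

THE INGREDIENTS.  (1) `OneLinkLawBiInvariance` (g12): bi-invariance `B ↦ UBV` and the SVD reduction `oneLinkVarianceBound_of_reps` /
`oneLinkPoincareSUN_of_reps` to the representatives `diagonal(u·σ)`, `‖u‖ = 1`, `0 ≤ σᵢ ≤ R`; (2) `OneLinkLawConjugation` (g13): `ν_{B̄} = suConj_* ν_B`,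
so a statement at `diagonal(u·σ)` is a statement at `diagonal(ū·σ)`; (3) `OneLinkCoverReduction` (g13): the tilt direction of Holley–Stroock, a statement
at a centre transfers to an `ℓ¹`-neighbour with the factor `exp(2η)`, `η = N Σⱼ ‖u′σ′ⱼ − uσⱼ‖`; (4) `OneLinkPermutationSymmetry` (g13): a statement at
`diagonal(u·σ)` is a statement at `diagonal(u·(σ∘π))`, so sorted `σ` suffice.

THIS FILE.
* `smulOne_mem_specialUnitaryGroup` : `ω·1 ∈ SU(N)` for `ω^N = 1` (the centre); ★ `varianceBoundAt_diagonal_centre` / `poincareAt_diagonal_centre` :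
  a statement at `diagonal(u·σ)` is a statement at `diagonal(ωu·σ)` (bi-invariance with `U = ω·1`, `V = 1`); `…_uncentre`, `…_unconj` : the inverse moves;
* `l1_rep_dist_le` / `l1_rep_dist_le_box` : the cell-radius bookkeeping `N Σⱼ‖uσⱼ − u_c σ_cⱼ‖ ≤ N (Σⱼ|σⱼ − σ_cⱼ| + ‖u − u_c‖ Σⱼ σ_cⱼ)` and, for phases
  `u = e^{iφ}`, `‖u − u_c‖ ≤ |φ − φ_c|` ((L3′)-type: a grid certificate's cover check is then rational arithmetic in `(σ, φ)`);
* ★★ `oneLinkVarianceBound_of_symCover` / `oneLinkPoincareSUN_of_symCover` : **the schema `OneLinkVarianceBound N R v` (resp. `OneLinkPoincareSUN N R c`)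
  follows from finitely many POINT statements at representative centres `diagonal(u_c·σ_c)` with constants `v_c` and an `ℓ¹` cover UP TO SYMMETRY**: every
  representative `(u, σ)` must be matched, after a centre rotation `u ↦ ωu` (`ω^N = 1`) and optionally a conjugation, to a centre within `η_c` with
  `exp(2η_c)·v_c ≤ v`.  For `SU(3)` this is word for word the SOUNDNESS paragraph of the cell `pub-balaban`'s C-iv certificate spec
  (`CERT-SPEC-sigma1-v2.md`: (L1) orbit reduction to `e^{iφ}diag(s)`, `φ ∈ [0, π/3]`; (L2′) `V(B′) ≤ V(B)·e^{6‖B′−B‖_nuc}`; cells `c` with `V(B) ≤ V(B_c)e^{6ρ_c}`),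
  now with (L1)/(L2′)/(L3′) as KERNEL theorems; what stays [analysis] is inside the point values ((S) closed form, (T) tails, (E) eigenvalue enclosures,
  (L4) torus blocks — ported separately in `OneLinkTorusBlocks`).
* ★★ `oneLinkVarianceBound_of_symCover_sorted` / `oneLinkPoincareSUN_of_symCover_sorted` : the same with the cover condition required only for SORTED
  (monotone) `σ` — the sorted chamber of (L1), via `OneLinkPermutationSymmetry.varianceLinAt_reps_of_sorted`.

References: Holley–Stroock 1987; Horn–Johnson Thm. 2.6.3 (SVD); H. Shen, R. Zhu, X. Zhu, CMP 400 (2023).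
-/

noncomputable section

open scoped Matrix ComplexConjugate BigOperators
open Matrix Complex MeasureTheory ProbabilityTheory Real
open Literature.MathematicalPhysics.QuantumFieldTheory
open Literature.MathematicalPhysics.QuantumFieldTheory.SUNBakryEmery
open Summit.QuantumFields.BalabanUV.InfraRed.StrongCouplingVarianceDoorSUN (OneLinkVarianceBound)
open Summit.QuantumFields.BalabanUV.InfraRed.StrongCouplingPoincareDoorSUN (OneLinkPoincareSUN)
open Summit.Ventures.YMGap.OneLinkBiInvariance
open Summit.Ventures.YMGap.OneLinkConjugation
open Summit.Ventures.YMGap.OneLinkCoverReduction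
open Summit.Ventures.YMGap.OneLinkPermutationSymmetry

namespace Summit.Ventures.YMGap.OneLinkCertificateReduction

variable {N : ℕ}

/-! ## 1. The centre `ω·1 ∈ SU(N)`, `ω^N = 1` -/

/-- An `N`-th root of unity has norm one (`N ≥ 1`). [folklore] -/
theorem norm_eq_one_of_pow_eq_one (hN : 1 ≤ N) {ω : ℂ} (hω : ω ^ N = 1) : ‖ω‖ = 1 := by
  have h : ‖ω‖ ^ N = 1 := by rw [← norm_pow, hω, norm_one]
  exact (pow_eq_one_iff_of_nonneg (norm_nonneg ω) (by omega)).1 h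

/-- An `N`-th root of unity is nonzero (`N ≥ 1`). [folklore] -/
theorem ne_zero_of_pow_eq_one (hN : 1 ≤ N) {ω : ℂ} (hω : ω ^ N = 1) : ω ≠ 0 := fun h => by
  have := norm_eq_one_of_pow_eq_one hN hω
  rw [h, norm_zero] at this
  exact zero_ne_one this

/-- **The centre**: `ω·1 ∈ SU(N)` whenever `ω^N = 1`. [folklore] -/
theorem smulOne_mem_specialUnitaryGroup (hN : 1 ≤ N) {ω : ℂ} (hω : ω ^ N = 1) :
    ω • (1 : Matrix (Fin N) (Fin N) ℂ) ∈ Matrix.specialUnitaryGroup (Fin N) ℂ := by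
  have h1 : ‖ω‖ = 1 := norm_eq_one_of_pow_eq_one hN hω
  have hzz : (starRingEnd ℂ) ω * ω = 1 := by
    rw [← Complex.normSq_eq_conj_mul_self, Complex.normSq_eq_norm_sq, h1]
    norm_num
  refine Matrix.mem_specialUnitaryGroup_iff.2 ⟨Matrix.mem_unitaryGroup_iff'.2 ?_, ?_⟩
  · rw [star_smul, Matrix.star_eq_conjTranspose, Matrix.conjTranspose_one, smul_mul_smul_comm, Matrix.one_mul, Complex.star_def, hzz, one_smul]
  · rw [Matrix.det_smul, Matrix.det_one, mul_one, Fintype.card_fin, hω]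

/-- `(ω·1) · diagonal(u·σ) · 1 = diagonal(ωu·σ)`. [folklore] -/
theorem centre_mul_diagonal_rep (ω u : ℂ) (σ : Fin N → ℝ) :
    ω • (1 : Matrix (Fin N) (Fin N) ℂ) * diagonal (fun i => u * ((σ i : ℝ) : ℂ)) * (1 : Matrix (Fin N) (Fin N) ℂ) =
      diagonal (fun i => ω * u * ((σ i : ℝ) : ℂ)) := by
  rw [Matrix.mul_one, Matrix.smul_mul, Matrix.one_mul, ← Matrix.diagonal_smul]
  congr 1
  funext i
  rw [Pi.smul_apply, smul_eq_mul, mul_assoc]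

/-! ## 2. Moving point statements along the symmetries of the representatives -/

/-- ★ **Centre**: H2 AT `diagonal(u·σ)` ⇒ H2 AT `diagonal(ωu·σ)` for `ω^N = 1` (bi-invariance with `U = ω·1`, `V = 1`). [folklore] -/
theorem varianceBoundAt_diagonal_centre (hN : 1 ≤ N) {ω : ℂ} (hω : ω ^ N = 1) {v : ℝ} {u : ℂ} {σ : Fin N → ℝ}
    (h : ∀ Δ : Matrix (Fin N) (Fin N) ℂ,
      Var[fun g : SUN N => (N : ℝ) * ((g : Matrix (Fin N) (Fin N) ℂ) * Δ).trace.re ;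
        (haarProbability (SUN N)).tilted fun g : SUN N => (N : ℝ) * ((g : Matrix (Fin N) (Fin N) ℂ) * diagonal (fun i => u * ((σ i : ℝ) : ℂ))).trace.re] ≤ v * frobNorm Δ ^ 2)
    (Δ : Matrix (Fin N) (Fin N) ℂ) :
    Var[fun g : SUN N => (N : ℝ) * ((g : Matrix (Fin N) (Fin N) ℂ) * Δ).trace.re ;
        (haarProbability (SUN N)).tilted fun g : SUN N => (N : ℝ) * ((g : Matrix (Fin N) (Fin N) ℂ) * diagonal (fun i => ω * u * ((σ i : ℝ) : ℂ))).trace.re] ≤ v * frobNorm Δ ^ 2 := by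
  have key := varianceBoundAt_conj h ⟨ω • (1 : Matrix (Fin N) (Fin N) ℂ), smulOne_mem_specialUnitaryGroup hN hω⟩ 1 Δ
  rw [OneMemClass.coe_one, centre_mul_diagonal_rep] at key
  exact key

/-- ★ **Centre, H1**: the Lipschitz Poincaré constant AT `diagonal(u·σ)` holds AT `diagonal(ωu·σ)`, `ω^N = 1`. [folklore] -/
theorem poincareAt_diagonal_centre (hN : 1 ≤ N) {ω : ℂ} (hω : ω ^ N = 1) {c : ℝ} {u : ℂ} {σ : Fin N → ℝ}
    (h : ∀ (ψ : SUN N → ℝ) (M : ℝ), 0 ≤ M → (∀ a b : SUN N, |ψ a - ψ b| ≤ M * suFrobDist a b) →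
      Var[ψ ; (haarProbability (SUN N)).tilted fun g : SUN N => (N : ℝ) * ((g : Matrix (Fin N) (Fin N) ℂ) * diagonal (fun i => u * ((σ i : ℝ) : ℂ))).trace.re] ≤ c * M ^ 2)
    (ψ : SUN N → ℝ) (M : ℝ) (hM : 0 ≤ M) (hψ : ∀ a b : SUN N, |ψ a - ψ b| ≤ M * suFrobDist a b) :
    Var[ψ ; (haarProbability (SUN N)).tilted fun g : SUN N => (N : ℝ) * ((g : Matrix (Fin N) (Fin N) ℂ) * diagonal (fun i => ω * u * ((σ i : ℝ) : ℂ))).trace.re] ≤ c * M ^ 2 := by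
  have key := poincareAt_conj h ⟨ω • (1 : Matrix (Fin N) (Fin N) ℂ), smulOne_mem_specialUnitaryGroup hN hω⟩ 1 ψ M hM hψ
  rw [OneMemClass.coe_one, centre_mul_diagonal_rep] at key
  exact key

/-- `ω⁻¹ (ω u) = u` for `ω ≠ 0`, inside a representative. [folklore] -/
theorem diagonal_rep_inv_mul_cancel {ω : ℂ} (hω : ω ≠ 0) (u : ℂ) (σ : Fin N → ℝ) :
    diagonal (fun i => ω⁻¹ * (ω * u) * ((σ i : ℝ) : ℂ)) = diagonal (fun i => u * ((σ i : ℝ) : ℂ)) := by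
  rw [← mul_assoc, inv_mul_cancel₀ hω, one_mul]

/-- **Un-centre**: H2 AT `diagonal(ωu·σ)` ⇒ H2 AT `diagonal(u·σ)` (`ω^N = 1`; apply the centre move with `ω⁻¹`). [folklore] -/
theorem varianceBoundAt_diagonal_uncentre (hN : 1 ≤ N) {ω : ℂ} (hω : ω ^ N = 1) {v : ℝ} {u : ℂ} {σ : Fin N → ℝ}
    (h : ∀ Δ : Matrix (Fin N) (Fin N) ℂ,
      Var[fun g : SUN N => (N : ℝ) * ((g : Matrix (Fin N) (Fin N) ℂ) * Δ).trace.re ;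
        (haarProbability (SUN N)).tilted fun g : SUN N => (N : ℝ) * ((g : Matrix (Fin N) (Fin N) ℂ) * diagonal (fun i => ω * u * ((σ i : ℝ) : ℂ))).trace.re] ≤ v * frobNorm Δ ^ 2)
    (Δ : Matrix (Fin N) (Fin N) ℂ) :
    Var[fun g : SUN N => (N : ℝ) * ((g : Matrix (Fin N) (Fin N) ℂ) * Δ).trace.re ;
        (haarProbability (SUN N)).tilted fun g : SUN N => (N : ℝ) * ((g : Matrix (Fin N) (Fin N) ℂ) * diagonal (fun i => u * ((σ i : ℝ) : ℂ))).trace.re] ≤ v * frobNorm Δ ^ 2 := by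
  have hω' : ω⁻¹ ^ N = 1 := by rw [inv_pow, hω, inv_one]
  have key := varianceBoundAt_diagonal_centre hN hω' h Δ
  rw [diagonal_rep_inv_mul_cancel (ne_zero_of_pow_eq_one hN hω)] at key
  exact key

/-- **Un-centre, H1.** [folklore] -/
theorem poincareAt_diagonal_uncentre (hN : 1 ≤ N) {ω : ℂ} (hω : ω ^ N = 1) {c : ℝ} {u : ℂ} {σ : Fin N → ℝ}
    (h : ∀ (ψ : SUN N → ℝ) (M : ℝ), 0 ≤ M → (∀ a b : SUN N, |ψ a - ψ b| ≤ M * suFrobDist a b) →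
      Var[ψ ; (haarProbability (SUN N)).tilted fun g : SUN N => (N : ℝ) * ((g : Matrix (Fin N) (Fin N) ℂ) * diagonal (fun i => ω * u * ((σ i : ℝ) : ℂ))).trace.re] ≤ c * M ^ 2)
    (ψ : SUN N → ℝ) (M : ℝ) (hM : 0 ≤ M) (hψ : ∀ a b : SUN N, |ψ a - ψ b| ≤ M * suFrobDist a b) :
    Var[ψ ; (haarProbability (SUN N)).tilted fun g : SUN N => (N : ℝ) * ((g : Matrix (Fin N) (Fin N) ℂ) * diagonal (fun i => u * ((σ i : ℝ) : ℂ))).trace.re] ≤ c * M ^ 2 := by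
  have hω' : ω⁻¹ ^ N = 1 := by rw [inv_pow, hω, inv_one]
  have key := poincareAt_diagonal_centre hN hω' h ψ M hM hψ
  rw [diagonal_rep_inv_mul_cancel (ne_zero_of_pow_eq_one hN hω)] at key
  exact key

/-- **Un-conjugate**: H2 AT `diagonal(w̄·σ)` ⇒ H2 AT `diagonal(w·σ)` (conjugate again). [folklore] -/
theorem varianceBoundAt_diagonal_unconj {v : ℝ} {w : ℂ} {σ : Fin N → ℝ}
    (h : ∀ Δ : Matrix (Fin N) (Fin N) ℂ,
      Var[fun g : SUN N => (N : ℝ) * ((g : Matrix (Fin N) (Fin N) ℂ) * Δ).trace.re ;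
        (haarProbability (SUN N)).tilted fun g : SUN N => (N : ℝ) * ((g : Matrix (Fin N) (Fin N) ℂ) * diagonal (fun i => starRingEnd ℂ w * ((σ i : ℝ) : ℂ))).trace.re] ≤ v * frobNorm Δ ^ 2)
    (Δ : Matrix (Fin N) (Fin N) ℂ) :
    Var[fun g : SUN N => (N : ℝ) * ((g : Matrix (Fin N) (Fin N) ℂ) * Δ).trace.re ;
        (haarProbability (SUN N)).tilted fun g : SUN N => (N : ℝ) * ((g : Matrix (Fin N) (Fin N) ℂ) * diagonal (fun i => w * ((σ i : ℝ) : ℂ))).trace.re] ≤ v * frobNorm Δ ^ 2 := by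
  have key := varianceBoundAt_diagonal_conj h Δ
  rw [Complex.conj_conj] at key
  exact key

/-- **Un-conjugate, H1.** [folklore] -/
theorem poincareAt_diagonal_unconj {c : ℝ} {w : ℂ} {σ : Fin N → ℝ}
    (h : ∀ (ψ : SUN N → ℝ) (M : ℝ), 0 ≤ M → (∀ a b : SUN N, |ψ a - ψ b| ≤ M * suFrobDist a b) →
      Var[ψ ; (haarProbability (SUN N)).tilted fun g : SUN N => (N : ℝ) * ((g : Matrix (Fin N) (Fin N) ℂ) * diagonal (fun i => starRingEnd ℂ w * ((σ i : ℝ) : ℂ))).trace.re] ≤ c * M ^ 2)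
    (ψ : SUN N → ℝ) (M : ℝ) (hM : 0 ≤ M) (hψ : ∀ a b : SUN N, |ψ a - ψ b| ≤ M * suFrobDist a b) :
    Var[ψ ; (haarProbability (SUN N)).tilted fun g : SUN N => (N : ℝ) * ((g : Matrix (Fin N) (Fin N) ℂ) * diagonal (fun i => w * ((σ i : ℝ) : ℂ))).trace.re] ≤ c * M ^ 2 := by
  have key := poincareAt_diagonal_conj h ψ M hM hψ
  rw [Complex.conj_conj] at key
  exact key

/-! ## 3. The cell-radius bookkeeping ((L3′)-type) -/

/-- **`ℓ¹` distance of two representatives**: `N Σⱼ ‖uσⱼ − u_c σ_cⱼ‖ ≤ N (Σⱼ |σⱼ − σ_cⱼ| + ‖u − u_c‖ Σⱼ σ_cⱼ)` for `‖u‖ = 1`, `σ_c ≥ 0`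
(`uσⱼ − u_cσ_cⱼ = u(σⱼ − σ_cⱼ) + (u − u_c)σ_cⱼ`). [folklore] -/
theorem l1_rep_dist_le {u uc : ℂ} (hu : ‖u‖ = 1) {σ σc : Fin N → ℝ} (hσc : ∀ j, 0 ≤ σc j) :
    (N : ℝ) * ∑ j, ‖u * ((σ j : ℝ) : ℂ) - uc * ((σc j : ℝ) : ℂ)‖ ≤
      (N : ℝ) * (∑ j, |σ j - σc j| + ‖u - uc‖ * ∑ j, σc j) := by
  refine mul_le_mul_of_nonneg_left ?_ (Nat.cast_nonneg N)
  rw [Finset.mul_sum, ← Finset.sum_add_distrib]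
  refine Finset.sum_le_sum fun j _ => ?_
  have hsplit : u * ((σ j : ℝ) : ℂ) - uc * ((σc j : ℝ) : ℂ) = u * (((σ j : ℝ) : ℂ) - ((σc j : ℝ) : ℂ)) + (u - uc) * ((σc j : ℝ) : ℂ) := by ring
  rw [hsplit]
  refine (norm_add_le _ _).trans (add_le_add ?_ ?_)
  · rw [norm_mul, hu, one_mul, ← Complex.ofReal_sub, Complex.norm_real, Real.norm_eq_abs]
  · rw [norm_mul, Complex.norm_real, Real.norm_eq_abs, abs_of_nonneg (hσc j)]

/-- Chord bound on the unit circle: `‖e^{iφ} − e^{iφ′}‖ ≤ |φ − φ′|`. [folklore] -/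
theorem norm_cexp_I_mul_sub_le (φ φ' : ℝ) :
    ‖Complex.exp (Complex.I * φ) - Complex.exp (Complex.I * φ')‖ ≤ |φ - φ'| := by
  have hfac : Complex.exp (Complex.I * φ) - Complex.exp (Complex.I * φ') =
      Complex.exp (Complex.I * φ') * (Complex.exp (Complex.I * ((φ - φ' : ℝ) : ℂ)) - 1) := by
    rw [mul_sub, mul_one, ← Complex.exp_add, Complex.ofReal_sub]
    ring_nf
  rw [hfac, norm_mul, Complex.norm_exp_I_mul_ofReal, one_mul]
  exact (Real.norm_exp_I_mul_ofReal_sub_one_le).trans (le_of_eq (Real.norm_eq_abs _))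

/-- **Cell-radius bookkeeping in `(σ, φ)` coordinates** ((L3′) as used by a grid certificate): for `u = e^{iφ}`, `u_c = e^{iφ_c}` and `σ_c ≥ 0`,
`N Σⱼ ‖uσⱼ − u_cσ_cⱼ‖ ≤ N (Σⱼ |σⱼ − σ_cⱼ| + |φ − φ_c| Σⱼ σ_cⱼ)`. [folklore] -/
theorem l1_rep_dist_le_box (φ φc : ℝ) {σ σc : Fin N → ℝ} (hσc : ∀ j, 0 ≤ σc j) :
    (N : ℝ) * ∑ j, ‖Complex.exp (Complex.I * φ) * ((σ j : ℝ) : ℂ) - Complex.exp (Complex.I * φc) * ((σc j : ℝ) : ℂ)‖ ≤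
      (N : ℝ) * (∑ j, |σ j - σc j| + |φ - φc| * ∑ j, σc j) := by
  refine (l1_rep_dist_le (Complex.norm_exp_I_mul_ofReal φ) hσc).trans (mul_le_mul_of_nonneg_left ?_ (Nat.cast_nonneg N))
  refine add_le_add le_rfl (mul_le_mul_of_nonneg_right (norm_cexp_I_mul_sub_le φ φc) ?_)
  exact Finset.sum_nonneg fun j _ => hσc j

/-! ## 4. ★★ The schemas from point statements at representative centres + a cover up to symmetry -/

/-- ★★ **`OneLinkVarianceBound N R v` from a symmetrised finite cover.**  DATA: centres `(u_c, σ_c)` (any index type; `Fin m` in a certificate) with point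
bounds `v_c` — `Var_{ν_{diagonal(u_c·σ_c)}}(N Re tr gΔ) ≤ v_c‖Δ‖_F²` for all `Δ` — and radii `η_c`.  COVER CONDITION: for every representative `(u, σ)`,
`‖u‖ = 1`, `0 ≤ σⱼ ≤ R`, there are a centre `c`, a root of unity `ω` (`ω^N = 1`) and a phase `ũ ∈ {ωu, conj(ωu)}` with `N Σⱼ ‖ũσⱼ − u_cσ_cⱼ‖ ≤ η_c` and
`exp(2η_c)·v_c ≤ v`.  CONCLUSION: `OneLinkVarianceBound N R v`.  (SVD reps ∘ centre ∘ conjugation ∘ Holley–Stroock cover.) [folklore] -/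
theorem oneLinkVarianceBound_of_symCover (hN : 1 ≤ N) {ι : Sort*} {R v : ℝ} (uC : ι → ℂ) (σC : ι → Fin N → ℝ) (vC η : ι → ℝ)
    (hcert : ∀ (i : ι) (Δ : Matrix (Fin N) (Fin N) ℂ),
      Var[fun g : SUN N => (N : ℝ) * ((g : Matrix (Fin N) (Fin N) ℂ) * Δ).trace.re ;
        (haarProbability (SUN N)).tilted fun g : SUN N => (N : ℝ) * ((g : Matrix (Fin N) (Fin N) ℂ) * diagonal (fun j => uC i * ((σC i j : ℝ) : ℂ))).trace.re] ≤ vC i * frobNorm Δ ^ 2)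
    (hcover : ∀ (u : ℂ) (σ : Fin N → ℝ), ‖u‖ = 1 → (∀ j, 0 ≤ σ j) → (∀ j, σ j ≤ R) →
      ∃ (i : ι) (ω ut : ℂ), ω ^ N = 1 ∧ (ut = ω * u ∨ ut = starRingEnd ℂ (ω * u)) ∧
        (N : ℝ) * ∑ j, ‖ut * ((σ j : ℝ) : ℂ) - uC i * ((σC i j : ℝ) : ℂ)‖ ≤ η i ∧ Real.exp (2 * η i) * vC i ≤ v) :
    OneLinkVarianceBound N R v := by
  refine oneLinkVarianceBound_of_reps hN fun u σ hu hσ0 hσR => ?_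
  obtain ⟨i, ω, ut, hω, hut, hnear, hvi⟩ := hcover u σ hu hσ0 hσR
  -- the bound `v` at `diagonal(ut·σ)` by the cover lemma
  have hut_bound : ∀ Δ : Matrix (Fin N) (Fin N) ℂ,
      Var[fun g : SUN N => (N : ℝ) * ((g : Matrix (Fin N) (Fin N) ℂ) * Δ).trace.re ;
        (haarProbability (SUN N)).tilted fun g : SUN N => (N : ℝ) * ((g : Matrix (Fin N) (Fin N) ℂ) * diagonal (fun i => ut * ((σ i : ℝ) : ℂ))).trace.re] ≤ v * frobNorm Δ ^ 2 := fun Δ =>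
    (varianceLinAt_diagonal_of_near (hcert i) hnear Δ).trans (mul_le_mul_of_nonneg_right hvi (sq_nonneg _))
  -- undo the conjugation (if any), then the centre rotation
  have hωu : ∀ Δ : Matrix (Fin N) (Fin N) ℂ,
      Var[fun g : SUN N => (N : ℝ) * ((g : Matrix (Fin N) (Fin N) ℂ) * Δ).trace.re ;
        (haarProbability (SUN N)).tilted fun g : SUN N => (N : ℝ) * ((g : Matrix (Fin N) (Fin N) ℂ) * diagonal (fun i => ω * u * ((σ i : ℝ) : ℂ))).trace.re] ≤ v * frobNorm Δ ^ 2 := by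
    rcases hut with rfl | rfl
    · exact hut_bound
    · exact varianceBoundAt_diagonal_unconj hut_bound
  exact varianceBoundAt_diagonal_uncentre hN hω hωu

/-- ★★ **`OneLinkPoincareSUN N R c` from a symmetrised finite cover** — as `oneLinkVarianceBound_of_symCover`, for the Lipschitz Poincaré constant
(point constants `c_c` at the centres, `exp(2η_c)·c_c ≤ c`). [folklore] -/
theorem oneLinkPoincareSUN_of_symCover (hN : 1 ≤ N) {ι : Sort*} {R c : ℝ} (uC : ι → ℂ) (σC : ι → Fin N → ℝ) (cC η : ι → ℝ)
    (hcert : ∀ (i : ι) (ψ : SUN N → ℝ) (M : ℝ), 0 ≤ M → (∀ a b : SUN N, |ψ a - ψ b| ≤ M * suFrobDist a b) →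
      Var[ψ ; (haarProbability (SUN N)).tilted fun g : SUN N => (N : ℝ) * ((g : Matrix (Fin N) (Fin N) ℂ) * diagonal (fun j => uC i * ((σC i j : ℝ) : ℂ))).trace.re] ≤ cC i * M ^ 2)
    (hcover : ∀ (u : ℂ) (σ : Fin N → ℝ), ‖u‖ = 1 → (∀ j, 0 ≤ σ j) → (∀ j, σ j ≤ R) →
      ∃ (i : ι) (ω ut : ℂ), ω ^ N = 1 ∧ (ut = ω * u ∨ ut = starRingEnd ℂ (ω * u)) ∧
        (N : ℝ) * ∑ j, ‖ut * ((σ j : ℝ) : ℂ) - uC i * ((σC i j : ℝ) : ℂ)‖ ≤ η i ∧ Real.exp (2 * η i) * cC i ≤ c) :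
    OneLinkPoincareSUN N R c := by
  refine oneLinkPoincareSUN_of_reps hN fun u σ hu hσ0 hσR => ?_
  obtain ⟨i, ω, ut, hω, hut, hnear, hci⟩ := hcover u σ hu hσ0 hσR
  have hut_bound : ∀ (ψ : SUN N → ℝ) (M : ℝ), 0 ≤ M → (∀ a b : SUN N, |ψ a - ψ b| ≤ M * suFrobDist a b) →
      Var[ψ ; (haarProbability (SUN N)).tilted fun g : SUN N => (N : ℝ) * ((g : Matrix (Fin N) (Fin N) ℂ) * diagonal (fun i => ut * ((σ i : ℝ) : ℂ))).trace.re] ≤ c * M ^ 2 := fun ψ M hM hψ =>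
    (poincareAt_diagonal_of_near (hcert i) hnear ψ M hM hψ).trans (mul_le_mul_of_nonneg_right hci (sq_nonneg _))
  have hωu : ∀ (ψ : SUN N → ℝ) (M : ℝ), 0 ≤ M → (∀ a b : SUN N, |ψ a - ψ b| ≤ M * suFrobDist a b) →
      Var[ψ ; (haarProbability (SUN N)).tilted fun g : SUN N => (N : ℝ) * ((g : Matrix (Fin N) (Fin N) ℂ) * diagonal (fun i => ω * u * ((σ i : ℝ) : ℂ))).trace.re] ≤ c * M ^ 2 := by
    rcases hut with rfl | rfl
    · exact hut_bound
    · exact poincareAt_diagonal_unconj hut_bound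
  exact poincareAt_diagonal_uncentre hN hω hωu

/-! ## 5. ★★ The same with the cover restricted to the SORTED chamber -/

/-- ★★ **`OneLinkVarianceBound N R v` from a symmetrised finite cover of the SORTED chamber**: as `oneLinkVarianceBound_of_symCover`, but the cover
condition is required only for monotone `σ` (`σ₀ ≤ σ₁ ≤ … ≤ σ_{N−1}`, all in `[0, R]`). [folklore] -/
theorem oneLinkVarianceBound_of_symCover_sorted (hN : 1 ≤ N) {ι : Sort*} {R v : ℝ} (uC : ι → ℂ) (σC : ι → Fin N → ℝ) (vC η : ι → ℝ)
    (hcert : ∀ (i : ι) (Δ : Matrix (Fin N) (Fin N) ℂ),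
      Var[fun g : SUN N => (N : ℝ) * ((g : Matrix (Fin N) (Fin N) ℂ) * Δ).trace.re ;
        (haarProbability (SUN N)).tilted fun g : SUN N => (N : ℝ) * ((g : Matrix (Fin N) (Fin N) ℂ) * diagonal (fun j => uC i * ((σC i j : ℝ) : ℂ))).trace.re] ≤ vC i * frobNorm Δ ^ 2)
    (hcover : ∀ (u : ℂ) (σ : Fin N → ℝ), ‖u‖ = 1 → (∀ j, 0 ≤ σ j) → (∀ j, σ j ≤ R) → Monotone σ →
      ∃ (i : ι) (ω ut : ℂ), ω ^ N = 1 ∧ (ut = ω * u ∨ ut = starRingEnd ℂ (ω * u)) ∧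
        (N : ℝ) * ∑ j, ‖ut * ((σ j : ℝ) : ℂ) - uC i * ((σC i j : ℝ) : ℂ)‖ ≤ η i ∧ Real.exp (2 * η i) * vC i ≤ v) :
    OneLinkVarianceBound N R v := by
  refine oneLinkVarianceBound_of_reps hN (varianceLinAt_reps_of_sorted hN fun u σ hu hσ0 hσR hmono => ?_)
  obtain ⟨i, ω, ut, hω, hut, hnear, hvi⟩ := hcover u σ hu hσ0 hσR hmono
  have hut_bound : ∀ Δ : Matrix (Fin N) (Fin N) ℂ,
      Var[fun g : SUN N => (N : ℝ) * ((g : Matrix (Fin N) (Fin N) ℂ) * Δ).trace.re ;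
        (haarProbability (SUN N)).tilted fun g : SUN N => (N : ℝ) * ((g : Matrix (Fin N) (Fin N) ℂ) * diagonal (fun i => ut * ((σ i : ℝ) : ℂ))).trace.re] ≤ v * frobNorm Δ ^ 2 := fun Δ =>
    (varianceLinAt_diagonal_of_near (hcert i) hnear Δ).trans (mul_le_mul_of_nonneg_right hvi (sq_nonneg _))
  have hωu : ∀ Δ : Matrix (Fin N) (Fin N) ℂ,
      Var[fun g : SUN N => (N : ℝ) * ((g : Matrix (Fin N) (Fin N) ℂ) * Δ).trace.re ;
        (haarProbability (SUN N)).tilted fun g : SUN N => (N : ℝ) * ((g : Matrix (Fin N) (Fin N) ℂ) * diagonal (fun i => ω * u * ((σ i : ℝ) : ℂ))).trace.re] ≤ v * frobNorm Δ ^ 2 := by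
    rcases hut with rfl | rfl
    · exact hut_bound
    · exact varianceBoundAt_diagonal_unconj hut_bound
  exact varianceBoundAt_diagonal_uncentre hN hω hωu

/-- ★★ **`OneLinkPoincareSUN N R c` from a symmetrised finite cover of the SORTED chamber.** [folklore] -/
theorem oneLinkPoincareSUN_of_symCover_sorted (hN : 1 ≤ N) {ι : Sort*} {R c : ℝ} (uC : ι → ℂ) (σC : ι → Fin N → ℝ) (cC η : ι → ℝ)
    (hcert : ∀ (i : ι) (ψ : SUN N → ℝ) (M : ℝ), 0 ≤ M → (∀ a b : SUN N, |ψ a - ψ b| ≤ M * suFrobDist a b) →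
      Var[ψ ; (haarProbability (SUN N)).tilted fun g : SUN N => (N : ℝ) * ((g : Matrix (Fin N) (Fin N) ℂ) * diagonal (fun j => uC i * ((σC i j : ℝ) : ℂ))).trace.re] ≤ cC i * M ^ 2)
    (hcover : ∀ (u : ℂ) (σ : Fin N → ℝ), ‖u‖ = 1 → (∀ j, 0 ≤ σ j) → (∀ j, σ j ≤ R) → Monotone σ →
      ∃ (i : ι) (ω ut : ℂ), ω ^ N = 1 ∧ (ut = ω * u ∨ ut = starRingEnd ℂ (ω * u)) ∧
        (N : ℝ) * ∑ j, ‖ut * ((σ j : ℝ) : ℂ) - uC i * ((σC i j : ℝ) : ℂ)‖ ≤ η i ∧ Real.exp (2 * η i) * cC i ≤ c) :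
    OneLinkPoincareSUN N R c := by
  refine oneLinkPoincareSUN_of_reps hN (poincareAt_reps_of_sorted hN fun u σ hu hσ0 hσR hmono => ?_)
  obtain ⟨i, ω, ut, hω, hut, hnear, hci⟩ := hcover u σ hu hσ0 hσR hmono
  have hut_bound : ∀ (ψ : SUN N → ℝ) (M : ℝ), 0 ≤ M → (∀ a b : SUN N, |ψ a - ψ b| ≤ M * suFrobDist a b) →
      Var[ψ ; (haarProbability (SUN N)).tilted fun g : SUN N => (N : ℝ) * ((g : Matrix (Fin N) (Fin N) ℂ) * diagonal (fun i => ut * ((σ i : ℝ) : ℂ))).trace.re] ≤ c * M ^ 2 := fun ψ M hM hψ =>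
    (poincareAt_diagonal_of_near (hcert i) hnear ψ M hM hψ).trans (mul_le_mul_of_nonneg_right hci (sq_nonneg _))
  have hωu : ∀ (ψ : SUN N → ℝ) (M : ℝ), 0 ≤ M → (∀ a b : SUN N, |ψ a - ψ b| ≤ M * suFrobDist a b) →
      Var[ψ ; (haarProbability (SUN N)).tilted fun g : SUN N => (N : ℝ) * ((g : Matrix (Fin N) (Fin N) ℂ) * diagonal (fun i => ω * u * ((σ i : ℝ) : ℂ))).trace.re] ≤ c * M ^ 2 := by
    rcases hut with rfl | rfl
    · exact hut_bound
    · exact poincareAt_diagonal_unconj hut_bound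
  exact poincareAt_diagonal_uncentre hN hω hωu

end Summit.Ventures.YMGap.OneLinkCertificateReduction

end
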